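import Mathlib
import Summits.PneNP.PneNP.Theorems.PstarGapLemma
import Summits.PneNP.PneNP.Theorems.PstarGapSupport
import Summits.PneNP.PneNP.Theorems.PstarPinGap

/-!
# T24.20 — the pin gap lemma `PinGap` holds (proof)

FRONTIER range-avoidance ladder, rung F-N3, ROUND 24 (cell `pnp-ideate`, gap-lemma programme `PstarGapLemma`; restricted-model
proof complexity — nothing here bears on `P` versus `NP`).

`PstarPinGap.PinGap` (planner seat p3, memo ROUND-24-PRESEED §13 R10(z′)): on a boundary-expanding pure-`P⋆` instance, a minimal
infeasible output set `J` (`#J ≤ r`) under a system `W` of UNIT PINS has `#J ≤ 2·#W`.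

PROOF.  This is the `d = 1` case of the support count already in the tree: `PstarGapSupport.card_le_of_sparse` — for ANY parity
system `W` whose constraint sets have at most `d` elements, a minimal `W`-infeasible `J` with `#J ≤ r` has `#J ≤ 2·d·#W`
(private XOR slots and private AND pairs outside the total support `wsupp W` are eliminable, so `#(bdry J ∖ wsupp W) ≤ #J`, and
`3#J ≤ 2#bdry J` gives `#J ≤ 2#(bdry J ∩ wsupp W) ≤ 2#wsupp W ≤ 2d#W`).  For unit pins every constraint set is a singleton, `d = 1`.
In particular the side condition of `UnitPins` that pinned variables avoid XOR slots is not needed: `card_le_two_mul_of_subsingleton`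
records the bound for every `W` whose constraint sets have at most one element.

Declared here: `card_le_two_mul_of_subsingleton` (the pin bound without the XOR-slot side condition), `pinGap : PinGap` (T24.20 by name).
-/

set_option linter.dupNamespace false -- `Summit.PneNP.PneNP.…`: summit = sub-problem name (D-0017 single-conjunct layout)

open Finset Literature.Computability.Complexity
open Summit.PneNP.PneNP.Theorems.PstarSALevel (BoundaryExpanding)
open Summit.PneNP.PneNP.Theorems.PstarGapLemma (MinInfeasible)
open Summit.PneNP.PneNP.Theorems.PstarGapSupport (card_le_of_sparse)
open Summit.PneNP.PneNP.Theorems.PstarPinGap (UnitPins PinGap)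

namespace Summit.PneNP.PneNP.Theorems.PstarPinGapProof

variable {n m : ℕ}

/-- **The pin bound without side conditions.**  On a boundary-expanding pure-`P⋆` instance, a minimal infeasible set of at most `r`
outputs under a parity system all of whose constraint sets have at most one element has at most `2·#W` outputs
(`PstarGapSupport.card_le_of_sparse` with `d = 1`). -/
theorem card_le_two_mul_of_subsingleton (I : LocalMap 4 n m) (hI : I.IsPure xorAndPred) {r : ℕ} (hB : BoundaryExpanding r I)
    {y : Fin m → Bool} {W : Finset (Finset (Fin n) × Bool)} (hW : ∀ e ∈ W, e.1.card ≤ 1) {J : Finset (Fin m)}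
    (hJr : J.card ≤ r) (hmin : MinInfeasible I y W J) : J.card ≤ 2 * W.card := by
  have h := card_le_of_sparse I hI hB hW hJr hmin
  rwa [mul_one] at h

/-- **T24.20 — `PinGap` holds**: under unit pins a minimal infeasible output set of a boundary-expanding pure-`P⋆` instance has at
most twice as many outputs as there are pins. -/
theorem pinGap : PinGap := by
  intro n m r I hI hB y W J hU hJr hmin
  refine card_le_two_mul_of_subsingleton I hI hB (fun e he => ?_) hJr hmin
  obtain ⟨v, hv, -⟩ := hU e he
  rw [hv, card_singleton]

end Summit.PneNP.PneNP.Theorems.PstarPinGapProof
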